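import Mathlib
import HarnessLib
import Summits.Ventures.LatticeQCDFlow.Scoring.BatchMeansTauInt
import Summits.Ventures.LatticeQCDFlow.Scoring.DoeblinPowerBatchMeans
import Summits.Ventures.LatticeQCDFlow.Exactness.NCMCGeneralSpaceDoeblinPowerEveryStart

/-!
# THE BATCH-MEANS ESTIMATE OF THE INTEGRATED AUTOCORRELATION TIME IS CONSISTENT UNDER A DOEBLIN
# POWER: `τ̂_N = (ab · SE²_BM) / (2 v̂_N) → τ_int` in probability, from any start, for every kernel with
# `(nHit κ m)(x, ·) ≥ ε ν`

HONEST FRAMING: exact (Metropolis-corrected) sampling algorithms for lattice gauge theory;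
figures of merit are autocorrelation/cost numbers at stated couplings and volumes; no
continuum-physics claim.

Venture `LatticeQCDFlow` (cell pub-lqcd), topic `Scoring`; FANOUT row 8 (`s0-cpn-nemc`, GEN-20).
NEW WORK of the cell, not a published result; no definition is introduced; nothing is cited as a
fact.  The cell's figure of merit is `τ_int` per cost; a run reports `τ̂ = σ̂²/(2 v̂)` with
`σ̂² = ab · SE²_BM` the batch-means estimate of the Green–Kubo variance `σ²_f` and `v̂_N` the sample
variance of the observable.  GEN-19's `Scoring/BatchMeansTauInt.lean` proved `τ̂ → τ_int(ρ_f)` in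
probability from any start for kernels minorised in ONE step.  This file is the same statement for a
DOEBLIN POWER `ε ν ≤ (nHit κ m)(z, ·)` (`0 < ε ≤ 1`, `0 < m`, measure form) — the certificate shape of
the cell's composite samplers: numerator by `Scoring/DoeblinPowerBatchMeans.lean`, denominator by row
13's strong law from any initial law under a Doeblin power
(`Exactness.GeneralNCMC.tendsto_sum_div_anyLaw_of_nHit_minorised`) applied to `f` and `f²`, ratio by
GEN-19's `tendstoInMeasure_div_const_limits`; `τ_int = σ²_f/(2 Var_π f)` by GEN-19's
`two_mul_mul_tauInt_eq`.  Nothing is cited.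

## Content

* `chain_sampleVariance_ae_tendsto_of_nHit` — `v̂_n → Var_π f = ∫ f̄² dπ` a.s. from any start;
* **`chain_batchMeans_tauInt_tendstoInMeasure_of_nHit`** — `a_n, b_n → ∞`, `N_n = b_n a_n`,
  `Var_π f ≠ 0`: `TendstoInMeasure P_{μ₀} (fun n x => σ̂²_n(x) / (2 v̂_{N_n}(x))) atTop (fun _ => tauInt ρ_f)`.

NOT CLAIMED: a rate; the windowing rules of the Γ-method; unbounded observables.
-/

noncomputable section

namespace Summit.Ventures.LatticeQCDFlow.Scoring

open MeasureTheory ProbabilityTheory Filter Finset Preorder Literature.Probability.MarkovChains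
open scoped ENNReal Topology

section TauInt

variable {Ω : Type*} [MeasurableSpace Ω]
  {κ : Kernel Ω Ω} [IsMarkovKernel κ] {ν : Measure Ω} [IsProbabilityMeasure ν] {ε : ℝ≥0∞}
  {π : Measure Ω} [IsProbabilityMeasure π] {m : ℕ}

/-- **The sample variance is strongly consistent from any start, under a Doeblin power**:
`(1/n) Σ_{t<n} f(X_t)² − ((1/n) Σ_{t<n} f(X_t))² → ∫ f² dπ − (∫ f dπ)² = ∫ (f − π f)² dπ` a.s. -/
theorem chain_sampleVariance_ae_tendsto_of_nHit (hπ : Kernel.Invariant κ π)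
    (hmin : ∀ z, ε • ν ≤ Exactness.nHit κ m z) (hε0 : 0 < ε)
    {f : Ω → ℝ} (hf : Measurable f) {C : ℝ} (hC : ∀ x, |f x| ≤ C)
    (μ₀ : Measure Ω) [IsProbabilityMeasure μ₀] :
    ∀ᵐ y ∂(Kernel.trajMeasure (X := fun _ : ℕ => Ω) μ₀
        (fun n : ℕ => κ.comap (fun h : (i : ↥(Finset.Iic n)) → Ω => h ⟨n, Finset.mem_Iic.2 le_rfl⟩)
          (measurable_pi_apply _))),
      Tendsto (fun n : ℕ => (∑ t ∈ Finset.range n, f (y t) ^ 2) / n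
        - ((∑ t ∈ Finset.range n, f (y t)) / n) ^ 2) atTop (𝓝 (∫ z, (f z - ∫ z', f z' ∂π) ^ 2 ∂π)) := by
  have hf2 : Measurable fun z => f z ^ 2 := hf.pow_const 2
  have hC0 : ∀ z, |f z ^ 2| ≤ C ^ 2 := fun z => by
    rw [abs_pow]; exact pow_le_pow_left₀ (abs_nonneg _) (hC z) 2
  have h1 := Exactness.GeneralNCMC.tendsto_sum_div_anyLaw_of_nHit_minorised hπ hε0.ne' hmin hf
    (integrable_of_bounded π hf hC) μ₀
  have h2 := Exactness.GeneralNCMC.tendsto_sum_div_anyLaw_of_nHit_minorised hπ hε0.ne' hmin hf2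
    (integrable_of_bounded π hf2 hC0) μ₀
  -- the limit: `∫ f² − (∫ f)² = ∫ (f − ∫ f)²`
  have hvar' : ∫ z, (f z - ∫ z', f z' ∂π) ^ 2 ∂π = ∫ z, f z ^ 2 ∂π - (∫ z, f z ∂π) ^ 2 := by
    have hi1 : Integrable f π := integrable_of_bounded π hf hC
    have hi2 : Integrable (fun z => f z ^ 2) π := integrable_of_bounded π hf2 hC0
    have hpt : ∀ z, (f z - ∫ z', f z' ∂π) ^ 2
        = f z ^ 2 - (2 * ∫ z', f z' ∂π) * f z + (∫ z', f z' ∂π) ^ 2 := fun z => by ring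
    have hi3 : Integrable (fun z => f z ^ 2 - (2 * ∫ z', f z' ∂π) * f z) π := hi2.sub (hi1.const_mul _)
    rw [integral_congr_ae (ae_of_all _ hpt), integral_add hi3 (integrable_const _),
      integral_sub hi2 (hi1.const_mul _), integral_const_mul, integral_const, probReal_univ, one_smul]
    ring
  rw [hvar']
  filter_upwards [h1, h2] with y hy1 hy2
  exact hy2.sub (hy1.pow 2)

/-- **THE BATCH-MEANS `τ_int` IS CONSISTENT UNDER A DOEBLIN POWER, FROM ANY START.**  `π`
invariant, `ε ν ≤ (nHit κ m)(z, ·)` for all `z` (`0 < ε ≤ 1`, `0 < m`), `|f| ≤ C` measurable with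
`Var_π f ≠ 0`; `a_n, b_n → ∞`, `N_n = b_n a_n`;
`σ̂²_n = a_n b_n · SE²_BM`, `v̂_n` the sample variance of `f(X_0), …, f(X_{N_n − 1})`.  Then
`σ̂²_n / (2 v̂_n) → tauInt(γ/γ₀) = 1/2 + Σ_{t≥1} γ_t/γ₀` in probability under `P_{μ₀}`, for EVERY initial
law `μ₀` (`γ_t = autocov κ π f̄ t`). -/
theorem chain_batchMeans_tauInt_tendstoInMeasure_of_nHit (hπ : Kernel.Invariant κ π)
    (hmin : ∀ z, ε • ν ≤ Exactness.nHit κ m z) (hε0 : 0 < ε) (hε1 : ε ≤ 1) (hm : 0 < m)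
    {f : Ω → ℝ} (hf : Measurable f) {C : ℝ} (hC : ∀ x, |f x| ≤ C)
    (hvar : autocov κ π (fun y => f y - ∫ z, f z ∂π) 0 ≠ 0)
    (μ₀ : Measure Ω) [IsProbabilityMeasure μ₀] {a b : ℕ → ℕ} (ha : Tendsto a atTop atTop)
    (hb : Tendsto b atTop atTop) :
    TendstoInMeasure (Kernel.trajMeasure (X := fun _ : ℕ => Ω) μ₀
        (fun n : ℕ => κ.comap (fun h : (i : ↥(Finset.Iic n)) → Ω => h ⟨n, Finset.mem_Iic.2 le_rfl⟩)
          (measurable_pi_apply _)))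
      (fun (n : ℕ) (x : ℕ → Ω) =>
        (((b n * a n : ℕ) : ℝ)
          * replicaSEsq (fun j (x : ℕ → Ω) => (∑ i ∈ Finset.range (b n), f (x (b n * j + i))) / (b n))
            (a n) x)
        / (2 * ((∑ t ∈ Finset.range (b n * a n), f (x t) ^ 2) / ((b n * a n : ℕ) : ℝ)
            - ((∑ t ∈ Finset.range (b n * a n), f (x t)) / ((b n * a n : ℕ) : ℝ)) ^ 2)))
      atTop (fun _ => tauInt (fun t => autocov κ π (fun y => f y - ∫ z, f z ∂π) t
        / autocov κ π (fun y => f y - ∫ z, f z ∂π) 0)) := by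
  set P := Kernel.trajMeasure (X := fun _ : ℕ => Ω) μ₀
      (fun n : ℕ => κ.comap (fun h : (i : ↥(Finset.Iic n)) → Ω => h ⟨n, Finset.mem_Iic.2 le_rfl⟩)
        (measurable_pi_apply _)) with hP
  set γ : ℕ → ℝ := fun t => autocov κ π (fun y => f y - ∫ z, f z ∂π) t with hγ
  -- the target: `σ²_f / (2 γ₀) = tauInt (γ/γ₀)`
  have h2γ : 2 * γ 0 ≠ 0 := mul_ne_zero two_ne_zero hvar
  have hσ2 : (∫ y, (f y - ∫ z, f z ∂π) ^ 2 ∂π)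
      + 2 * ∑' k, ∫ y, (f y - ∫ z, f z ∂π) * (kop κ)^[k + 1] (fun y => f y - ∫ z, f z ∂π) y ∂π
      = 2 * γ 0 * tauInt (fun t => γ t / γ 0) := by
    rw [two_mul_mul_tauInt_eq hvar, autocov_zero]
    rfl
  have htarget : tauInt (fun t => γ t / γ 0)
      = ((∫ y, (f y - ∫ z, f z ∂π) ^ 2 ∂π)
        + 2 * ∑' k, ∫ y, (f y - ∫ z, f z ∂π) * (kop κ)^[k + 1] (fun y => f y - ∫ z, f z ∂π) y ∂π)
        / (2 * γ 0) := by
    rw [hσ2, mul_div_cancel_left₀ _ h2γ]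
  -- numerator: batch means → σ²_f in measure
  have hnum := chain_batchMeans_sigmaHat_tendstoInMeasure_of_nHit hπ
    (Exactness.GeneralNCMC.minorised_setwise hmin) hε0 hε1 hm hf hC μ₀ ha hb
  rw [← hP] at hnum
  -- denominator: `2 v̂_{N_n} → 2 γ₀` a.s., hence in measure
  have hN : Tendsto (fun n => b n * a n) atTop atTop := hb.atTop_mul_atTop₀ ha
  have hγ0 : γ 0 = ∫ z, (f z - ∫ z', f z' ∂π) ^ 2 ∂π :=
    autocov_zero κ π (fun y => f y - ∫ z, f z ∂π)
  have hden_ae : ∀ᵐ x ∂P, Tendsto (fun n : ℕ =>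
      2 * ((∑ t ∈ Finset.range (b n * a n), f (x t) ^ 2) / ((b n * a n : ℕ) : ℝ)
        - ((∑ t ∈ Finset.range (b n * a n), f (x t)) / ((b n * a n : ℕ) : ℝ)) ^ 2)) atTop
      (𝓝 (2 * γ 0)) := by
    have h := chain_sampleVariance_ae_tendsto_of_nHit (κ := κ) (ν := ν) hπ hmin hε0 hf hC μ₀
    rw [← hP] at h
    filter_upwards [h] with x hx
    rw [hγ0]
    exact (hx.comp hN).const_mul 2
  have hdm : ∀ n, Measurable fun x : ℕ → Ω =>
      2 * ((∑ t ∈ Finset.range (b n * a n), f (x t) ^ 2) / ((b n * a n : ℕ) : ℝ)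
        - ((∑ t ∈ Finset.range (b n * a n), f (x t)) / ((b n * a n : ℕ) : ℝ)) ^ 2) := fun n =>
    measurable_const.mul (((Finset.measurable_sum _ fun t _ =>
      (hf.comp (measurable_pi_apply t)).pow_const 2).div_const _).sub
      (((Finset.measurable_sum _ fun t _ => hf.comp (measurable_pi_apply t)).div_const _).pow_const 2))
  have hden : TendstoInMeasure P (fun (n : ℕ) (x : ℕ → Ω) =>
      2 * ((∑ t ∈ Finset.range (b n * a n), f (x t) ^ 2) / ((b n * a n : ℕ) : ℝ)
        - ((∑ t ∈ Finset.range (b n * a n), f (x t)) / ((b n * a n : ℕ) : ℝ)) ^ 2)) atTop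
      (fun _ => 2 * γ 0) :=
    tendstoInMeasure_of_tendsto_ae (fun n => (hdm n).aestronglyMeasurable) hden_ae
  have hratio := tendstoInMeasure_div_const_limits
    (fun n => (measurable_batchMeans_sigmaHat hf (a n) (b n)).aestronglyMeasurable)
    (fun n => (hdm n).aestronglyMeasurable) hnum hden h2γ
  rw [htarget]
  exact hratio

end TauInt

end Summit.Ventures.LatticeQCDFlow.Scoring

end
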